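import Summits.Ventures.QEDPrecision.Diagrams.VolkovOnShellSetsGrouped

/-!
Venture QEDPrecision / cell `pub-qed`, unit `pub-qed-int-2` (INT-2, gen 9). HONEST FRAMING: independent recomputation; certified
where stated, statistical where stated; no new-physics claim.  NEW WORK of the cell (structural lemmas about the unit's OWN
model), not a published result: nothing here is cited as a fact anywhere.
Staged copy: HOME/lean/int2/VolkovOnShellSetsAdditive.lean (declarations byte-identical).

# Additivity of the model's polynomial arithmetic — closure of a class from INDEPENDENT group sums

Device (3) for class-size kernel certificates (devices (1), (2): `VolkovOnShellSetsGrouped`).  The polynomials of the model are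
association lists built by `pins` (insert one term, keys kept sorted, zero coefficients dropped).  This file proves, once and
for all and WITHOUT computation: (a) `coeffAt_pins` / `coeffAt_padd` — `pins` and `padd` are additive on coefficients, for ALL
lists; (b) `canon_pins` / `canon_blockResidual` — everything `blockResidual` produces is CANONICAL (keys strictly increasing, no
zero coefficient), so it is `[]` as soon as all its coefficients vanish (`eq_nil_of_canon`); hence (c) `closes_of_groupSums` —
if a list of rows is cut into groups whose residual sums are certified separately (each by one kernel-sized `decide` against a
literal) and the literal group sums add up to `[]`, the whole list closes; and (d) `closes_perm` — closure does not depend on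
the order of the rows.  With (c) the groups of a large class are certified in INDEPENDENT files (no chain of suffix sums as in
`VolkovOnShellSetsOrder10C131Closes`), and with (d) the closure is stated over `List.range' 1 N` itself.

NOT CLAIMED: anything numerical; these are list lemmas about the model's own arithmetic.
-/

namespace Summit.Ventures.QEDPrecision.Diagrams

/-- the coefficient of the monomial key `k` (sum over all entries carrying that key). -/
def coeffAt (k : ℕ) (p : List (ℕ × ℤ)) : ℤ := (p.map (fun m => if m.1 = k then m.2 else 0)).sum

/-- the empty polynomial has no coefficients. -/
@[simp] theorem coeffAt_nil (k : ℕ) : coeffAt k [] = 0 := rfl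

/-- coefficient of a cons. -/
@[simp] theorem coeffAt_cons (k : ℕ) (m : ℕ × ℤ) (t : List (ℕ × ℤ)) :
    coeffAt k (m :: t) = (if m.1 = k then m.2 else 0) + coeffAt k t := by
  simp [coeffAt]

/-- coefficients are additive under concatenation. -/
theorem coeffAt_append (k : ℕ) (p q : List (ℕ × ℤ)) : coeffAt k (p ++ q) = coeffAt k p + coeffAt k q := by
  induction p with
  | nil => simp
  | cons m t ih => simp [ih, add_assoc]

/-- `pins` adds `c` to the coefficient of `j` and changes nothing else — for every list. -/
theorem coeffAt_pins (k j : ℕ) (c : ℤ) (p : List (ℕ × ℤ)) :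
    coeffAt k (pins j c p) = (if j = k then c else 0) + coeffAt k p := by
  induction p with
  | nil =>
      unfold pins
      by_cases hc : c = 0
      · subst hc; simp
      · simp [hc]
  | cons q t ih =>
      unfold pins
      by_cases hlt : Nat.blt j q.1 = true
      · rw [if_pos hlt]
        by_cases hc : c = 0
        · subst hc; simp
        · simp [hc]
      · rw [if_neg hlt]
        by_cases hj : j = q.1
        · subst hj
          simp only [beq_self_eq_true, ↓reduceIte]
          by_cases hs : c + q.2 = 0
          · simp only [hs, beq_self_eq_true, ↓reduceIte, coeffAt_cons]
            by_cases hk : q.1 = k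
            · simp [hk]; omega
            · simp [hk]
          · have : (c + q.2 == 0) = false := by simp [hs]
            simp only [this, coeffAt_cons]
            by_cases hk : q.1 = k
            · simp [hk]; ring
            · simp [hk]
        · have : (j == q.1) = false := by simp [hj]
          simp only [this, Bool.false_eq_true, ↓reduceIte, coeffAt_cons, ih]
          ring

/-- `padd` is coefficient-wise addition — for every pair of lists. -/
theorem coeffAt_padd (k : ℕ) (p q : List (ℕ × ℤ)) : coeffAt k (padd p q) = coeffAt k p + coeffAt k q := by
  induction p with
  | nil => simp [padd]
  | cons m t ih =>
      have : padd (m :: t) q = pins m.1 m.2 (padd t q) := rfl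
      rw [this, coeffAt_pins, ih, coeffAt_cons]
      ring

/-- the coefficient of `k` in a block residual is the sum of the rows' coefficients. -/
theorem coeffAt_blockResidual (k n : ℕ) (rows : List (ℕ × List (ℕ × ℕ))) (b : List ℕ) :
    coeffAt k (blockResidual n rows b) = (b.map (fun i => coeffAt k (rowResidual n rows i))).sum := by
  induction b with
  | nil => rfl
  | cons i t ih =>
      have : blockResidual n rows (i :: t) = padd (rowResidual n rows i) (blockResidual n rows t) := rfl
      rw [this, coeffAt_padd, ih]
      simp

/-- the coefficient of `k` in the residual of concatenated groups is the sum over the groups. -/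
theorem coeffAt_blockResidual_flatten (k n : ℕ) (rows : List (ℕ × List (ℕ × ℕ))) (gs : List (List ℕ)) :
    coeffAt k (blockResidual n rows gs.flatten) = (gs.map (fun g => coeffAt k (blockResidual n rows g))).sum := by
  induction gs with
  | nil => rfl
  | cons g t ih =>
      simp only [List.flatten_cons, List.map_cons, List.sum_cons, coeffAt_blockResidual, List.map_append, List.sum_append] at *
      rw [ih]

/-- `psum` is coefficient-wise summation. -/
theorem coeffAt_psum (k : ℕ) (Ps : List (List (ℕ × ℤ))) : coeffAt k (psum Ps) = (Ps.map (coeffAt k)).sum := by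
  induction Ps with
  | nil => rfl
  | cons P t ih =>
      have : psum (P :: t) = padd P (psum t) := rfl
      rw [this, coeffAt_padd, ih]
      simp

/-! Canonical form = keys strictly increasing (`List.Pairwise (·.1 < ·.1)`) and no zero coefficient; written out as a
conjunction in every statement below (no named predicate). -/

/-- an entry of `pins j c p` is an entry of `p` or carries the key `j`. -/
theorem mem_pins {j : ℕ} {c : ℤ} {p : List (ℕ × ℤ)} {m : ℕ × ℤ} (h : m ∈ pins j c p) : m ∈ p ∨ m.1 = j := by
  induction p with
  | nil =>
      unfold pins at h
      by_cases hc : c = 0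
      · subst hc; simp at h
      · simp [hc] at h; exact Or.inr (by rw [h])
  | cons q t ih =>
      unfold pins at h
      by_cases hlt : Nat.blt j q.1 = true
      · rw [if_pos hlt] at h
        by_cases hc : c = 0
        · subst hc; simp at h; exact Or.inl (by simpa using h)
        · simp [hc] at h
          rcases h with h | h | h
          · exact Or.inr (by rw [h])
          · exact Or.inl (by simp [h])
          · exact Or.inl (by simp [h])
      · rw [if_neg hlt] at h
        by_cases hj : j = q.1
        · subst hj
          simp only [beq_self_eq_true, ↓reduceIte] at h
          by_cases hs : c + q.2 = 0
          · simp only [hs, beq_self_eq_true, ↓reduceIte] at h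
            exact Or.inl (List.mem_cons_of_mem _ h)
          · have hb : (c + q.2 == 0) = false := by simp [hs]
            simp only [hb] at h
            rcases List.mem_cons.mp h with h | h
            · exact Or.inr (by rw [h])
            · exact Or.inl (List.mem_cons_of_mem _ h)
        · have hb : (j == q.1) = false := by simp [hj]
          simp only [hb] at h
          rcases List.mem_cons.mp h with h | h
          · exact Or.inl (by simp [h])
          · rcases ih h with h' | h'
            · exact Or.inl (List.mem_cons_of_mem _ h')
            · exact Or.inr h'

/-- `pins` preserves canonical form. -/
theorem canon_pins (j : ℕ) (c : ℤ) {p : List (ℕ × ℤ)}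
    (hp : p.Pairwise (fun a b : ℕ × ℤ => a.1 < b.1) ∧ ∀ m ∈ p, m.2 ≠ 0) :
    (pins j c p).Pairwise (fun a b : ℕ × ℤ => a.1 < b.1) ∧ ∀ m ∈ pins j c p, m.2 ≠ 0 := by
  induction p with
  | nil =>
      unfold pins
      by_cases hc : c = 0
      · subst hc; simp
      · simp [hc]
  | cons q t ih =>
      obtain ⟨hpw, hnz⟩ := hp
      have hpt : t.Pairwise (fun a b : ℕ × ℤ => a.1 < b.1) ∧ ∀ m ∈ t, m.2 ≠ 0 :=
        ⟨(List.pairwise_cons.mp hpw).2, fun m hm => hnz m (List.mem_cons_of_mem _ hm)⟩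
      have hqt : ∀ b ∈ t, q.1 < b.1 := (List.pairwise_cons.mp hpw).1
      unfold pins
      by_cases hlt : Nat.blt j q.1 = true
      · rw [if_pos hlt]
        have hjq : j < q.1 := by simpa [Nat.blt_eq] using hlt
        by_cases hc : c = 0
        · subst hc
          have h : (q :: t).Pairwise (fun a b : ℕ × ℤ => a.1 < b.1) ∧ ∀ m ∈ q :: t, m.2 ≠ 0 := ⟨hpw, hnz⟩
          simpa using h
        · simp only [show (c == 0) = false by simp [hc]]
          refine ⟨List.pairwise_cons.mpr ⟨?_, hpw⟩, ?_⟩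
          · intro b hb
            rcases List.mem_cons.mp hb with h | h
            · rw [h]; exact hjq
            · exact lt_trans hjq (hqt b h)
          · intro m hm
            rcases List.mem_cons.mp hm with h | h
            · rw [h]; exact hc
            · exact hnz m h
      · rw [if_neg hlt]
        have hjq : ¬ j < q.1 := by simpa [Nat.blt_eq] using hlt
        by_cases hj : j = q.1
        · subst hj
          simp only [beq_self_eq_true, ↓reduceIte]
          by_cases hs : c + q.2 = 0
          · simp only [hs, beq_self_eq_true, ↓reduceIte]; exact hpt
          · simp only [show (c + q.2 == 0) = false by simp [hs]]
            refine ⟨List.pairwise_cons.mpr ⟨?_, hpt.1⟩, ?_⟩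
            · intro b hb; exact hqt b hb
            · intro m hm
              rcases List.mem_cons.mp hm with h | h
              · rw [h]; exact hs
              · exact hpt.2 m h
        · simp only [show (j == q.1) = false by simp [hj]]
          have hqj : q.1 < j := by omega
          refine ⟨List.pairwise_cons.mpr ⟨?_, (ih hpt).1⟩, ?_⟩
          · intro b hb
            rcases mem_pins hb with h | h
            · exact hqt b h
            · rw [h]; exact hqj
          · intro m hm
            rcases List.mem_cons.mp hm with h | h
            · rw [h]; exact hnz q (by simp)
            · exact (ih hpt).2 m h

/-- `padd p q` is canonical when `q` is. -/
theorem canon_padd (p : List (ℕ × ℤ)) {q : List (ℕ × ℤ)}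
    (hq : q.Pairwise (fun a b : ℕ × ℤ => a.1 < b.1) ∧ ∀ m ∈ q, m.2 ≠ 0) :
    (padd p q).Pairwise (fun a b : ℕ × ℤ => a.1 < b.1) ∧ ∀ m ∈ padd p q, m.2 ≠ 0 := by
  induction p with
  | nil => simpa [padd] using hq
  | cons m t ih =>
      have : padd (m :: t) q = pins m.1 m.2 (padd t q) := rfl
      rw [this]; exact canon_pins _ _ ih

/-- every block residual is canonical. -/
theorem canon_blockResidual (n : ℕ) (rows : List (ℕ × List (ℕ × ℕ))) (b : List ℕ) :
    (blockResidual n rows b).Pairwise (fun a b : ℕ × ℤ => a.1 < b.1) ∧ ∀ m ∈ blockResidual n rows b, m.2 ≠ 0 := by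
  induction b with
  | nil => exact ⟨List.Pairwise.nil, by simp [blockResidual]⟩
  | cons i t ih =>
      have : blockResidual n rows (i :: t) = padd (rowResidual n rows i) (blockResidual n rows t) := rfl
      rw [this]; exact canon_padd _ ih

/-- a key that does not occur has coefficient zero. -/
theorem coeffAt_eq_zero_of_keys_ne {k : ℕ} {p : List (ℕ × ℤ)} (h : ∀ m ∈ p, m.1 ≠ k) : coeffAt k p = 0 := by
  induction p with
  | nil => rfl
  | cons m t ih =>
      rw [coeffAt_cons, if_neg (h m (by simp)), ih (fun m' hm' => h m' (List.mem_cons_of_mem _ hm'))]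
      simp

/-- a canonical polynomial all of whose coefficients vanish is `[]`. -/
theorem eq_nil_of_canon {p : List (ℕ × ℤ)} (hp : p.Pairwise (fun a b : ℕ × ℤ => a.1 < b.1) ∧ ∀ m ∈ p, m.2 ≠ 0)
    (h0 : ∀ k, coeffAt k p = 0) : p = [] := by
  cases p with
  | nil => rfl
  | cons m t =>
      exfalso
      have hk : coeffAt m.1 t = 0 :=
        coeffAt_eq_zero_of_keys_ne (fun b hb => Nat.ne_of_gt ((List.pairwise_cons.mp hp.1).1 b hb))
      have := h0 m.1
      rw [coeffAt_cons, if_pos rfl, hk, add_zero] at this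
      exact hp.2 m (by simp) this

/-- closure ⇔ all coefficients of the block residual vanish. -/
theorem closes_iff_coeffAt (n : ℕ) (rows : List (ℕ × List (ℕ × ℕ))) (b : List ℕ) :
    closes n rows b = true ↔ ∀ k, coeffAt k (blockResidual n rows b) = 0 := by
  constructor
  · intro h k
    have : blockResidual n rows b = [] := by simpa [closes, List.isEmpty_iff] using h
    rw [this]; rfl
  · intro h
    simp [closes, eq_nil_of_canon (canon_blockResidual n rows b) h]

/-- CLOSURE FROM INDEPENDENT GROUP SUMS: if the rows are cut into groups `gs` whose residual sums are the literals `Ps`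
(each certified separately) and the literals add up to `[]`, the whole list of rows closes. -/
theorem closes_of_groupSums (n : ℕ) (rows : List (ℕ × List (ℕ × ℕ))) (gs : List (List ℕ))
    (Ps : List (List (ℕ × ℤ)))
    (h : gs.map (blockResidual n rows) = Ps) (h0 : psum Ps = []) : closes n rows gs.flatten = true := by
  rw [closes_iff_coeffAt]
  intro k
  rw [coeffAt_blockResidual_flatten]
  have : gs.map (fun g => coeffAt k (blockResidual n rows g)) = Ps.map (coeffAt k) := by
    rw [← h, List.map_map]; rfl
  rw [this, ← coeffAt_psum, h0]; rfl

/-- closure does not depend on the order of the rows. -/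
theorem closes_perm (n : ℕ) (rows : List (ℕ × List (ℕ × ℕ))) {b b' : List ℕ} (h : b.Perm b') :
    closes n rows b = closes n rows b' := by
  have key : ∀ k, coeffAt k (blockResidual n rows b) = coeffAt k (blockResidual n rows b') := fun k => by
    rw [coeffAt_blockResidual, coeffAt_blockResidual]; exact (h.map _).sum_eq
  rcases hb : closes n rows b' with _ | _
  · -- b' does not close
    by_contra hc
    have hc' : closes n rows b = true := by simpa using hc
    have : closes n rows b' = true :=
      (closes_iff_coeffAt n rows b').mpr (fun k => (key k) ▸ (closes_iff_coeffAt n rows b).mp hc' k)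
    rw [hb] at this; exact Bool.false_ne_true this
  · exact (closes_iff_coeffAt n rows b).mpr
      (fun k => (key k).trans ((closes_iff_coeffAt n rows b').mp hb k))

/-- sanity example (2 loops): rows 1, 2 as two one-row groups; the two literal group sums cancel. -/
theorem closes_of_groupSums_example : closes 2 printedRows2 [1, 2] = true :=
  closes_of_groupSums 2 printedRows2 [[1], [2]]
    [polyOf [([(1, [2,0,2]), (3, [2,0,2])], 2)], polyOf [([(1, [2,0,2]), (3, [2,0,2])], -2)]]
    (by decide +kernel) (by decide +kernel)

/-- sanity example: a permutation of rows is decided by the kernel (`List.Perm` is decidable). -/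
example : [3, 1, 2].Perm (List.range' 1 3) := by decide +kernel

end Summit.Ventures.QEDPrecision.Diagrams
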